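import Summits.BirchSwinnertonDyer.BirchSwinnertonDyer.Theorems.ByReductionTypeAtTwoTorsionEulerCharDefect
import HarnessLib

set_option linter.dupNamespace false -- `…BirchSwinnertonDyer.BirchSwinnertonDyer…` is the cell's nested layout (D-0017)
set_option autoImplicit false

/-!
# Greenberg LNM 1716 Lemma 4.7 WITH RATIONAL `p`-TORSION, part 3b: `#(Sel_{p^∞}(E/K_∞))_γ ≤ #(C/D)` over the same receptacle

Cell `bsd-2adic` (run/shared/lean/pub/bsd-2adic/), seat `bsd-2adic-tower-1` GEN 31; `--supports stmt-BirchSwinnertonDyer-19271`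
(helper). THEOREMS ONLY (no definition, no named fact, no `sorry`); closes no item; nothing booked; BSD is not proved by any of this.

R. Greenberg, LNM 1716 (1999), §4 Lemma 4.7 (pp. 107–108) and p. 104. Continuation of part 3a (`…TorsionEulerCharDefect`): with the
same receptacle `δ : H¹(Γ_{K_{v₀}}, E)(p) → C` (kernel `loc_{v₀}(U)`) and `D = (δ ∘ loc_{v₀})(Θ)`:

* `natCard_endCoinvariants_le_of_defect` — **`#(Sel_{p^∞}(E/K_∞))_γ ≤ #(C/D)`**: the group `Ω` of representatives `(t, z₀)`
  (`(γ−1)t ∈ Sel_∞`, `t` Kummer away from `v₀`, `loc_{v₀} t = r_{v₀} z₀`) maps ONTO `(Sel_∞)_γ` by part 2's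
  `exists_coinv_representative` («DIV» + local surjectivity + AEU + Cassels-with-torsion away from `v₀`), and `ω ↦ [δ z₀] ∈ C/D`
  kills only classes that vanish in `(Sel_∞)_γ` (part 2's `exists_mem_selmerInfty_conj_sub_eq_of_lift`).

HONEST FRAMING: as part 3a. The reverse inequalities (Lemma 4.6 on `Γ`-invariants) are NOT claimed. Closes no item; no summit
statement is proved; the Birch–Swinnerton-Dyer conjecture is NOT proved by any of this.

References: [GreenbergLNM1716] §4 p. 104, Lemmas 4.6–4.7 (pp. 105–108), Prop. 4.13 and p. 123; [GreenbergVatsal2000] §2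
pp. 16–17; [MilneADT2006] I Thm. 4.10, Thm. 6.13.
-/

noncomputable section

open scoped Classical NumberField

open NumberField IsDedekindDomain Field

namespace Summit.BirchSwinnertonDyer.BirchSwinnertonDyer.Theorems.TorsionEulerChar

open Literature.NumberTheory.EllipticCurves Literature.NumberTheory.GaloisRepresentations
  WeierstrassCurve ZpExtension Literature.NumberTheory.EllipticCurves.IwasawaAlgebra
  Literature.NumberTheory.EllipticCurves.IwasawaDual
  Literature.NumberTheory.EllipticCurves.GreenbergVatsal2000 Literature.NumberTheory.EllipticCurves.GreenbergSelmer
  Literature.NumberTheory.EllipticCurves.Rank1Residual Summit.BirchSwinnertonDyer.Rank1Residual.X2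

/-! ## §0 Index calculus -/

/-- If `π₁ : Ω → A` is onto and `ker π₂ ≤ ker π₁` for `π₂ : Ω → B` with `B` finite, then `#A ≤ #π₂(Ω)` (`A` is a quotient of
`Ω/ker π₂ ≅ π₂(Ω)`). [folklore] -/
private theorem natCard_le_natCard_range_of_ker_le {Ω A B : Type*} [AddCommGroup Ω] [AddCommGroup A] [AddCommGroup B]
    (π₁ : Ω →+ A) (π₂ : Ω →+ B) (h₁ : Function.Surjective π₁) (hker : π₂.ker ≤ π₁.ker) [Finite B] :
    Nat.card A ≤ Nat.card π₂.range := by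
  let e := QuotientAddGroup.quotientKerEquivRange π₂
  haveI : Finite (Ω ⧸ π₂.ker) := Finite.of_equiv _ e.toEquiv.symm
  let f : Ω ⧸ π₂.ker →+ A := QuotientAddGroup.lift π₂.ker π₁ hker
  have hf : Function.Surjective f := fun a ↦ by
    obtain ⟨ω, rfl⟩ := h₁ a
    exact ⟨QuotientAddGroup.mk ω, QuotientAddGroup.lift_mk _ hker ω⟩
  calc Nat.card A ≤ Nat.card (Ω ⧸ π₂.ker) := Nat.card_le_card_of_surjective f hf
    _ = Nat.card π₂.range := Nat.card_congr e.toEquiv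

/-! ## §1 `#(Sel_∞)_γ ≤ #(C/D)` -/

variable {K : Type} [Field K] [NumberField K] (W : WeierstrassCurve K) [W.IsElliptic] (p : ℕ) [hp : Fact p.Prime]
  (κ : ZpExtension K p) {γ : absoluteGaloisGroup K}

set_option maxHeartbeats 800000 in
-- (the group `Ω` of representatives and two sealed maps out of it; the default budget covers about a third of it)
/-- **(II) `#(Sel_{p^∞}(E/K_∞))_γ ≤ #(C/D)`.** Same data as (I) (`Θ`, `U`, `lamP`, the receptacle `δ`), plus «DIV» (`hdiv`) and the
local surjectivity (`hsurj`): every class of `(Sel_∞)_γ` is `(γ−1)t` for a representative `(t, z₀)` of part 2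
(`exists_coinv_representative`), and if `δ(z₀)` lies in `D = (δ ∘ lamP)(Θ)` then, up to `U`, `z₀ = loc_{v₀} Y` with `Y ∈ Θ` and
part 2's `exists_mem_selmerInfty_conj_sub_eq_of_lift` kills the class. So `(Sel_∞)_γ` is a quotient of a subgroup of `C/D`.
[cite: GreenbergLNM1716, §4 p. 104, Lemma 4.7 (pp. 107–108)] -/
theorem natCard_endCoinvariants_le_of_defect {C : Type*} [AddCommGroup C] [Finite C]
    (hκ : κ.IsCyclotomic) (hγ : κ.IsTopGenerator γ) (hSel : Finite (W.selmerGroupPInfty p))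
    (hdiv : ∀ s : W.subgroupH1 p κ.kerSubgroup,
      ∃ t : W.subgroupH1 p κ.kerSubgroup, W.conjH1 p κ.kerSubgroup γ t - t = s)
    (hsurj : ∀ (v : HeightOneSpectrum (𝓞 K))
      (c : discreteH1 (localSubgroup κ.kerSubgroup (v.adicCompletion K)) (localPoints W (v.adicCompletion K))),
      (∃ k : ℕ, p ^ k • c = 0) →
      (∀ δ : absoluteGaloisGroup (v.adicCompletion K),
        Literature.NumberTheory.EllipticCurves.conjH1 (localSubgroup κ.kerSubgroup (v.adicCompletion K))
          (localPoints W (v.adicCompletion K)) δ c = c) →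
      ∃ x : discreteH1 (localSubgroup (⊤ : Subgroup (absoluteGaloisGroup K)) (v.adicCompletion K))
          (localPoints W (v.adicCompletion K)),
        (∃ k : ℕ, p ^ k • x = 0) ∧
        Literature.NumberTheory.EllipticCurves.resOfLe (localPoints W (v.adicCompletion K))
          (Subgroup.comap_mono le_top :
            localSubgroup κ.kerSubgroup (v.adicCompletion K) ≤
              localSubgroup (⊤ : Subgroup (absoluteGaloisGroup K)) (v.adicCompletion K)) x = c)
    (S : Finset (HeightOneSpectrum (𝓞 K))) (hS : ∀ v ∉ S, ((p : ℕ) : 𝓞 K) ∉ v.asIdeal ∧ W.HasGoodReductionAt v)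
    (v₀ : HeightOneSpectrum (𝓞 K)) (hv₀ : v₀ ∉ S)
    (Θ : AddSubgroup (W.subgroupH1 p (⊤ : Subgroup (absoluteGaloisGroup K))))
    (hΘ : ∀ Y : W.subgroupH1 p (⊤ : Subgroup (absoluteGaloisGroup K)), Y ∈ Θ ↔
        Y ∈ unramifiedOutside (⊤ : Subgroup (absoluteGaloisGroup K)) (W.geomPrimaryTorsion p) p
            ((↑S : Set (HeightOneSpectrum (𝓞 K))) ∪ {v₀}) ∧
          (∀ v ∈ S, Literature.NumberTheory.EllipticCurves.resOfLe (localPoints W (v.adicCompletion K))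
            (Subgroup.comap_mono le_top :
              localSubgroup κ.kerSubgroup (v.adicCompletion K) ≤
                localSubgroup (⊤ : Subgroup (absoluteGaloisGroup K)) (v.adicCompletion K))
            (W.localResOver p ⊤ (v.adicCompletion K) Y) = 0) ∧
          ∀ w : InfinitePlace K, W.localResOver p ⊤ w.Completion Y = 0)
    (U : AddSubgroup (W.subgroupH1 p (⊤ : Subgroup (absoluteGaloisGroup K))))
    (hU : ∀ u : W.subgroupH1 p (⊤ : Subgroup (absoluteGaloisGroup K)), u ∈ U ↔
        u ∈ unramifiedOutside (⊤ : Subgroup (absoluteGaloisGroup K)) (W.geomPrimaryTorsion p) p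
            ((↑S : Set (HeightOneSpectrum (𝓞 K))) ∪ {v₀}) ∧
          (∀ v ∈ S, W.localResOver p ⊤ (v.adicCompletion K) u = 0) ∧
          ∀ w : InfinitePlace K, W.localResOver p ⊤ w.Completion u = 0)
    (lamP : Θ →+ AddCommGroup.primaryComponent
      (discreteH1 (localSubgroup (⊤ : Subgroup (absoluteGaloisGroup K)) (v₀.adicCompletion K))
        (localPoints W (v₀.adicCompletion K))) p)
    (hlamP : ∀ Y : Θ, (lamP Y : discreteH1 (localSubgroup (⊤ : Subgroup (absoluteGaloisGroup K)) (v₀.adicCompletion K))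
        (localPoints W (v₀.adicCompletion K))) = W.localResOver p ⊤ (v₀.adicCompletion K) Y)
    (δ : AddCommGroup.primaryComponent
      (discreteH1 (localSubgroup (⊤ : Subgroup (absoluteGaloisGroup K)) (v₀.adicCompletion K))
        (localPoints W (v₀.adicCompletion K))) p →+ C)
    (hδ : ∀ z : AddCommGroup.primaryComponent
        (discreteH1 (localSubgroup (⊤ : Subgroup (absoluteGaloisGroup K)) (v₀.adicCompletion K))
          (localPoints W (v₀.adicCompletion K))) p, δ z = 0 ↔
      (z : discreteH1 (localSubgroup (⊤ : Subgroup (absoluteGaloisGroup K)) (v₀.adicCompletion K))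
        (localPoints W (v₀.adicCompletion K))) ∈ AddSubgroup.map (W.localResOver p ⊤ (v₀.adicCompletion K)) U) :
    Nat.card (EndCoinvariants (W.conjSelmerInfty κ γ - 1)) ≤ Nat.card (C ⧸ (δ.comp lamP).range) := by
  classical
  let Pv := discreteH1 (localSubgroup (⊤ : Subgroup (absoluteGaloisGroup K)) (v₀.adicCompletion K))
    (localPoints W (v₀.adicCompletion K))
  let P₀ : AddSubgroup Pv := AddCommGroup.primaryComponent Pv p
  have hle : ∀ (E : Type) [Field E] [Algebra K E],
      localSubgroup κ.kerSubgroup E ≤ localSubgroup (⊤ : Subgroup (absoluteGaloisGroup K)) E :=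
    fun E _ _ ↦ Subgroup.comap_mono le_top
  haveI : Finite (C ⧸ (δ.comp lamP).range) := Finite.of_surjective _ (QuotientAddGroup.mk'_surjective _)
  -- the group `Ω` of representatives `(t, z₀)` (sealed)
  obtain ⟨Ω, hΩ⟩ : ∃ Ω : AddSubgroup (W.subgroupH1 p κ.kerSubgroup × Pv),
      ∀ ω : W.subgroupH1 p κ.kerSubgroup × Pv, ω ∈ Ω ↔
        W.conjH1 p κ.kerSubgroup γ ω.1 - ω.1 ∈ W.selmerInfty κ ∧
        (∀ v : HeightOneSpectrum (𝓞 K), v ≠ v₀ → ω.1 ∈ W.localKerOver p κ.kerSubgroup (v.adicCompletion K)) ∧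
        (∀ w : InfinitePlace K, ω.1 ∈ W.localKerOver p κ.kerSubgroup w.Completion) ∧
        ω.2 ∈ P₀ ∧
        W.localResOver p κ.kerSubgroup (v₀.adicCompletion K) ω.1 =
          Literature.NumberTheory.EllipticCurves.resOfLe (localPoints W (v₀.adicCompletion K))
            (hle (v₀.adicCompletion K)) ω.2 := by
    refine ⟨{ carrier := {ω | W.conjH1 p κ.kerSubgroup γ ω.1 - ω.1 ∈ W.selmerInfty κ ∧
                          (∀ v : HeightOneSpectrum (𝓞 K), v ≠ v₀ →
                            ω.1 ∈ W.localKerOver p κ.kerSubgroup (v.adicCompletion K)) ∧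
                          (∀ w : InfinitePlace K, ω.1 ∈ W.localKerOver p κ.kerSubgroup w.Completion) ∧
                          ω.2 ∈ P₀ ∧
                          W.localResOver p κ.kerSubgroup (v₀.adicCompletion K) ω.1 =
                            Literature.NumberTheory.EllipticCurves.resOfLe (localPoints W (v₀.adicCompletion K))
                              (hle (v₀.adicCompletion K)) ω.2},
              zero_mem' := ?zero, add_mem' := ?add, neg_mem' := ?neg }, fun _ ↦ Iff.rfl⟩
    case zero =>
      simp only [Set.mem_setOf_eq]
      refine ⟨?_, fun v _ ↦ zero_mem _, fun w ↦ zero_mem _, zero_mem _, ?_⟩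
      · rw [Prod.fst_zero, map_zero, sub_zero]; exact zero_mem _
      · rw [Prod.fst_zero, Prod.snd_zero, map_zero, map_zero]
    case add =>
      intro a b ha hb
      simp only [Set.mem_setOf_eq] at ha hb ⊢
      obtain ⟨ha1, ha2, ha3, ha4, ha5⟩ := ha
      obtain ⟨hb1, hb2, hb3, hb4, hb5⟩ := hb
      refine ⟨?_, fun v hv ↦ ?_, fun w ↦ ?_, ?_, ?_⟩
      · have h : W.conjH1 p κ.kerSubgroup γ (a + b).1 - (a + b).1 =
            (W.conjH1 p κ.kerSubgroup γ a.1 - a.1) + (W.conjH1 p κ.kerSubgroup γ b.1 - b.1) := by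
          rw [Prod.fst_add, map_add]; abel
        rw [h]; exact add_mem ha1 hb1
      · rw [Prod.fst_add]; exact add_mem (ha2 v hv) (hb2 v hv)
      · rw [Prod.fst_add]; exact add_mem (ha3 w) (hb3 w)
      · rw [Prod.snd_add]; exact add_mem ha4 hb4
      · rw [Prod.fst_add, Prod.snd_add, map_add, map_add, ha5, hb5]
    case neg =>
      intro a ha
      simp only [Set.mem_setOf_eq] at ha ⊢
      obtain ⟨ha1, ha2, ha3, ha4, ha5⟩ := ha
      refine ⟨?_, fun v hv ↦ ?_, fun w ↦ ?_, ?_, ?_⟩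
      · have h : W.conjH1 p κ.kerSubgroup γ (-a).1 - (-a).1 = -(W.conjH1 p κ.kerSubgroup γ a.1 - a.1) := by
          rw [Prod.fst_neg, map_neg]; abel
        rw [h]; exact neg_mem ha1
      · rw [Prod.fst_neg]; exact neg_mem (ha2 v hv)
      · rw [Prod.fst_neg]; exact neg_mem (ha3 w)
      · rw [Prod.snd_neg]; exact neg_mem ha4
      · rw [Prod.fst_neg, Prod.snd_neg, map_neg, map_neg, ha5]
  -- `π₁' : Ω → (Sel_∞)_γ`, `ω ↦ [(γ − 1) t]` (sealed), onto by part 2's representatives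
  obtain ⟨π₁', hπ₁'⟩ : ∃ π₁' : Ω →+ EndCoinvariants (W.conjSelmerInfty κ γ - 1), ∀ ω : Ω,
      π₁' ω = (((⟨W.conjH1 p κ.kerSubgroup γ ω.1.1 - ω.1.1, ((hΩ ω.1).mp ω.2).1⟩ : W.selmerInfty κ)) :
        EndCoinvariants (W.conjSelmerInfty κ γ - 1)) := by
    refine ⟨(QuotientAddGroup.mk' _).comp
      ((((W.conjH1 p κ.kerSubgroup γ - AddMonoidHom.id _).comp
        ((AddMonoidHom.fst _ _).comp Ω.subtype)).codRestrict (W.selmerInfty κ)) fun ω ↦ ?_), fun _ ↦ rfl⟩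
    change W.conjH1 p κ.kerSubgroup γ ω.1.1 - ω.1.1 ∈ W.selmerInfty κ
    exact ((hΩ ω.1).mp ω.2).1
  have hsurj₁ : Function.Surjective π₁' := by
    intro q
    induction q using QuotientAddGroup.induction_on with
    | H s =>
      obtain ⟨t, z₀, h1, h2, h3, h4, h5⟩ := exists_coinv_representative W p κ hκ hγ hSel hdiv hsurj v₀ s s.2
      have hω : ((t, z₀) : W.subgroupH1 p κ.kerSubgroup × Pv) ∈ Ω :=
        (hΩ _).mpr ⟨by rw [h1]; exact s.2, h2, h3, (AddCommGroup.mem_primaryComponent).mpr h4, h5⟩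
      refine ⟨⟨(t, z₀), hω⟩, ?_⟩
      rw [hπ₁']
      congr 1
      exact Subtype.ext h1
  -- `π₂' : Ω → C/D`, `ω ↦ [δ z₀]` (sealed)
  obtain ⟨π₂', hπ₂'⟩ : ∃ π₂' : Ω →+ C ⧸ (δ.comp lamP).range, ∀ ω : Ω,
      π₂' ω = QuotientAddGroup.mk' (δ.comp lamP).range (δ ⟨ω.1.2, ((hΩ ω.1).mp ω.2).2.2.2.1⟩) :=
    ⟨(QuotientAddGroup.mk' (δ.comp lamP).range).comp (δ.comp
      (((AddMonoidHom.snd _ _).comp Ω.subtype).codRestrict P₀ fun ω ↦ ((hΩ ω.1).mp ω.2).2.2.2.1)), fun _ ↦ rfl⟩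
  have hker : π₂'.ker ≤ π₁'.ker := by
    intro ω hω
    rw [AddMonoidHom.mem_ker] at hω ⊢
    obtain ⟨ht, htv, htw, hz₀, htz⟩ := (hΩ ω.1).mp ω.2
    -- `[δ z₀] = 0`: a `Θ`-class `Y` with `δ (loc_{v₀} Y) = δ z₀`, i.e. `loc_{v₀} Y ≡ z₀ (mod loc_{v₀} U)`
    rw [hπ₂', QuotientAddGroup.mk'_apply, QuotientAddGroup.eq_zero_iff, AddMonoidHom.mem_range] at hω
    obtain ⟨Y, hY⟩ := hω
    rw [AddMonoidHom.comp_apply, ← sub_eq_zero, ← map_sub, hδ, AddSubgroupClass.coe_sub, hlamP,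
      AddSubgroup.mem_map] at hY
    obtain ⟨u, huU, hu⟩ := hY
    obtain ⟨huH, huS, huinf⟩ := (hU u).mp huU
    obtain ⟨hYH, hYS, hYinf⟩ := (hΘ Y).mp Y.2
    -- part 2's second descent with `Y − u`
    obtain ⟨t'', ht''S, ht''⟩ := exists_mem_selmerInfty_conj_sub_eq_of_lift W p κ hκ hγ S hS v₀ hv₀ ω.1.1 ω.1.2 ht
      htv htw htz ((Y : W.subgroupH1 p (⊤ : Subgroup (absoluteGaloisGroup K))) - u) (AddSubgroup.sub_mem _ hYH huH)
      (fun v hv ↦ by rw [map_sub, huS v hv, sub_zero]; exact hYS v hv)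
      (fun w ↦ by rw [map_sub, hYinf w, huinf w, sub_zero])
      (by rw [map_sub, hu]; exact sub_sub_cancel _ _)
    rw [hπ₁', QuotientAddGroup.eq_zero_iff, AddMonoidHom.mem_range]
    refine ⟨⟨t'', ht''S⟩, Subtype.ext ?_⟩
    rw [AddMonoidHom.coe_coe, End_sub_apply, AddMonoid.End.one_apply, AddSubgroupClass.coe_sub,
      coe_conjSelmerInfty_apply]
    exact ht''
  exact (natCard_le_natCard_range_of_ker_le π₁' π₂' hsurj₁ hker).trans
    (Nat.card_le_card_of_injective _ π₂'.range.subtype_injective)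

end Summit.BirchSwinnertonDyer.BirchSwinnertonDyer.Theorems.TorsionEulerChar

end
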